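import Mathlib

/-!
# SoloBlind — the planar K3-skeleton filter: Plücker bookkeeping, the holomorphic-Lefschetz
# character formula, and the two inequalities that close the generic planar door

Solo seat `solo-HodgeConjecture-blind`, session s35 (HOME `work/s35/planar-filter-run.md`, scripts
`work/s35/planar_filter.py`, `phi_bound.py`, `phi_proof.py`, GAP data job `j153050`).

Context (paper statements, not formalised here).  By the monodromy-descent lemma (s34) a planar
seventh-form carrier forces the K3 surface to be an intermediate quotient `Y = S_G / H` of the Galois
closure `S_G → ℙ²` (group `G = S_d`) of the degree-`d` section cover of a plane curve `Γ ⊂ ℙ²^∨` of degree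
`d` and geometric genus `g`; in the generic Plücker stratum the branch curve `B = Γ^∨` has degree
`d^∨ = 2d + 2g - 2 = 2m` (`m := d + g - 1`), `f = 3d(d-2) - 6δ` cusps and `b = (d^∨(d^∨-1) - d - 3f)/2` nodes
(`δ = (d-1)(d-2)/2 - g`).  The HOME file proves (holomorphic Lefschetz on `S_G`; only transpositions,
3-cycles and double transpositions have fixed points) that, with `N = [S_d : H]` and `u, w, z` the
proportions of transpositions / 3-cycles / double transpositions of `S_d` lying in `H`,
  `χ(𝒪_Ỹ)/N = (3m² - 17m + 26 - 2g)/24 - u·m(m-3)/4 + w·(m+g-1)/3 + z·((m-1)(m-2) - 2g)/8`,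
and deduces that for `d ≥ 7`, `g ≥ 2` and `H` transitive, `H ≠ S_d`, one has `χ(𝒪_Ỹ) > 2`, so `Y` is never
birationally K3 (intransitive `H` are excluded by `q ≥ g`).  Kernel-checked here: the polynomial identities
behind that formula and its sanity value `1` at `H = S_d` (`Y = ℙ²`), and the two elementary inequalities
used in the proof — the `k = 0` transposition-clique inequality and the `a = 1` lower bound.
-/

namespace Summit.HodgeConjecture.HodgeConjecture.Theorems.SoloBlindPlanarSkeleton

/-- Plücker: the number of flexes of a nodal plane curve of degree `d` and geometric genus `g`,
`f = 3d(d-2) - 6δ` with `δ = (d-1)(d-2)/2 - g`, equals `3d + 6g - 6`. -/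
theorem flexes_eq (d g : ℚ) :
    3 * d * (d - 2) - 6 * ((d - 1) * (d - 2) / 2 - g) = 3 * d + 6 * g - 6 := by
  ring

/-- Plücker: with `m = d + g - 1` (so `d^∨ = 2m`) and `f = 3d + 6g - 6`, the number of bitangents
`b = (d^∨(d^∨ - 1) - d - 3f)/2` equals `2(m-1)(m-2) - 4g`. -/
theorem bitangents_eq (d g : ℚ) :
    ((2 * (d + g - 1)) * (2 * (d + g - 1) - 1) - d - 3 * (3 * d + 6 * g - 6)) / 2
      = 2 * ((d + g - 1) - 1) * ((d + g - 1) - 2) - 4 * g := by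
  ring

/-- The identity term of the character formula: with `m = d + g - 1`, `f = 3d+6g-6`,
`b = 2(m-1)(m-2) - 4g`, one has `(m-3)² + 2 + g - f/3 + b/4 = (3m² - 17m + 26 - 2g)/2`. -/
theorem identity_term (d g : ℚ) :
    let m := d + g - 1
    (m - 3) ^ 2 + 2 + g - (3 * d + 6 * g - 6) / 3 + (2 * (m - 1) * (m - 2) - 4 * g) / 4
      = (3 * m ^ 2 - 17 * m + 26 - 2 * g) / 2 := by
  intro m
  simp only [m]
  ring

/-- The transposition (mirror-curve) term: `2 - 2g - 2b - 2f + (d^∨)²/2 = 2m(3 - m)`,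
i.e. `(e(R_t) + R_t²)·4/(d-2)!` collapses to `-2m(m-3)` — negative for `m > 3`, the only negative term. -/
theorem transposition_term (d g : ℚ) :
    let m := d + g - 1
    2 - 2 * g - 2 * (2 * (m - 1) * (m - 2) - 4 * g) - 2 * (3 * d + 6 * g - 6) + (2 * m) ^ 2 / 2
      = 2 * m * (3 - m) := by
  intro m
  simp only [m]
  ring

/-- Sanity value of the character formula: for `H = S_d` (`u = w = z = 1`, `N = 1`, `Y = ℙ²`) the
normalised holomorphic Euler characteristic is identically `1 = χ(𝒪_{ℙ²})`, for all `d, g`. -/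
theorem chi_formula_at_full_group (m g : ℚ) :
    (3 * m ^ 2 - 17 * m + 26 - 2 * g) / 24 - m * (m - 3) / 4 + (m + g - 1) / 3
      + ((m - 1) * (m - 2) - 2 * g) / 8 = 1 := by
  ring

/-- The same formula in the variables actually used by the filter (`g = m + 1 - d`):
identity term `(3m² - 19m + 24 + 2d)/24`, 3-cycle weight `(2m - d)/3`, (2,2) weight `(m² - 5m + 2d)/8`. -/
theorem chi_formula_d_form (m d u w z : ℚ) :
    let g := m + 1 - d
    (3 * m ^ 2 - 17 * m + 26 - 2 * g) / 24 - u * (m * (m - 3)) / 4 + w * (m + g - 1) / 3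
        + z * ((m - 1) * (m - 2) - 2 * g) / 8
      = (3 * m ^ 2 - 19 * m + 24 + 2 * d) / 24 - u * (m * (m - 3)) / 4 + w * (2 * m - d) / 3
        + z * (m ^ 2 - 5 * m + 2 * d) / 8 := by
  intro g
  simp only [g]
  ring

/-- The `k = 0` (unblown-up K3) case needs `t_H / C(d,2) ≥ (d-2)/(d+1)` transpositions in `H`; but if no
transposition clique has `d - 1` vertices, at most `C(d-2,2) + 1` transpositions are available, and
`C(d-2,2) + 1 < (d-2)/(d+1) · C(d,2)` for `d ≥ 4` — equivalently `d² - d - 8 > 0`. -/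
theorem clique_gap (d : ℚ) (hd : 4 ≤ d) :
    ((d - 2) * (d - 3) / 2 + 1) * (d + 1) < (d - 2) * (d * (d - 1) / 2) := by
  nlinarith [hd, sq_nonneg (d - 4)]

/-- The `a = 1` branch (no transpositions in `H`): `χ(𝒪_Ỹ) ≥ N·(3m² - 19m + 24 + 2d)/24` with `N ≥ 1` and
`m ≥ d + 1`; the right-hand side is increasing in `m` for `m ≥ 4` and at `m = d + 1` equals
`(3d² - 11d + 8)/24`, which exceeds `2` as soon as `d ≥ 7`. -/
theorem a_one_value (d : ℚ) :
    3 * (d + 1) ^ 2 - 19 * (d + 1) + 24 + 2 * d = 3 * d ^ 2 - 11 * d + 8 := by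
  ring

/-- The `a = 1` value exceeds `2` for `d ≥ 7`. -/
theorem a_one_bound (d : ℚ) (hd : 7 ≤ d) : (2 : ℚ) < (3 * d ^ 2 - 11 * d + 8) / 24 := by
  nlinarith [hd]

/-- The `a = 1` identity term is non-decreasing in `m` for `m ≥ 4`. -/
theorem a_one_monotone (m : ℚ) (hm : 4 ≤ m) (d : ℚ) :
    3 * m ^ 2 - 19 * m + 24 + 2 * d ≤ 3 * (m + 1) ^ 2 - 19 * (m + 1) + 24 + 2 * d := by
  nlinarith [hm]

/-- Large-`d` branch (`a ≥ 2`, `d ≥ 301`): after bounding the three surviving terms, positivity reduces to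
the endpoint value of a decreasing cubic, `F((d-2)/2)/(d-2) = c₁(d-1)(d-3) - (d-2)(d-3)/8 + c₄ d(d-2)/8`
with `c₁ = 887/7248 = (3 - 19/302)/24` and `c₄ = 297/2416 = (1 - 5/302)/8`; it is positive for `d ≥ 3`. -/
theorem large_d_endpoint (d : ℚ) (hd : 3 ≤ d) :
    0 < (887 / 7248 : ℚ) * (d - 1) * (d - 3) - (d - 2) * (d - 3) / 8
        + (297 / 2416 : ℚ) * d * (d - 2) / 8 := by
  nlinarith [hd, sq_nonneg (d - 3)]

/-- and the cubic is decreasing because `2x(d-1) - 3x² ≤ (d-1)²/3` for every real `x`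
(so `F'(x) ≤ -(d-2)(d-3)/4 + c₄(d-1)²/3·8 < 0`). -/
theorem quad_max (x d : ℚ) : 2 * x * (d - 1) - 3 * x ^ 2 ≤ (d - 1) ^ 2 / 3 := by
  nlinarith [sq_nonneg (3 * x - (d - 1))]

/-- The derivative bound of the large-`d` cubic is negative for `d ≥ 6`. -/
theorem derivative_negative (d : ℚ) (hd : 6 ≤ d) :
    -((d - 2) * (d - 3)) / 4 + (297 / 2416 : ℚ) * ((d - 1) ^ 2 / 3) < 0 := by
  nlinarith [hd]

end Summit.HodgeConjecture.HodgeConjecture.Theorems.SoloBlindPlanarSkeleton
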